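/-
Copyright (c) 2026. All rights reserved.
Released under Apache 2.0 license as described in the file LICENSE.
-/
import Literature.Probability.FitznerVanDerHofstad2017.NobleBoundsNEnd
import HarnessLib

/-!
# Fitzner–van der Hofstad (2017), §6.1 (6.4): the generic letter package of a junction from the joint witnesses

[FvdH17] = R. Fitzner, R. van der Hofstad, *Generalized approach to the non-backtracking lace expansion*,
arXiv:1506.07977v2 (EJP 22 (2017), paper 43).  Page numbers refer to the arXiv version.

The chain inequality `prod_bondJ_mul_piPerc_jwCover_le_chain_of_packages` of `NobleBoundsNGrouped` (the typed
form of [FvdH17] (6.4), p. 58, `N = M + 2 ≥ 2`) consumes one LETTER PACKAGE `JPkg` per junction `k` of every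
variant piece `W_τ` ((4.66), p. 43).  `NobleBoundsNEnd` built the packages of the LAST junction with the fixed
grouping `glEnd`.  This module provides the junction-GENERIC form of that construction, for the middle and first
junctions (App. B rows of `B_pt`, [FvdH17] pp. 74–78) as much as for the last:

* §A: tools — a product of factors `≤ 1` against three of them; MONOTONICITY of packages in the target
  (`JPkg.mono`) and antitonicity in the facts (`JPkg.imp`).
* §B: the probability `junF` of a letter of junction `k` under a grouping `gl` and upgraded events `ev`, and its
  TWO-LEVEL READING `junF_le_of_lines` ((4.18), p. 35: a letter is bounded by the two-level disjoint-occurrence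
  probability of any injectively indexed family of its active lines, level `k ↦ 0`, `k + 1 ↦ 1`).
* §C: **the generic package from the joint witnesses** `nonempty_jPkg_of_joint`: for ANY junction `k`, ANY
  grouping `gl` whose cross-level letters join lower lines only with ENTRY slots of the upper level (the
  grouping rule behind [FvdH17] §4.4 "all paths involved in the above connections are bond disjoint, even when
  they occur in different levels", p. 43, certified by clause (4.65) = `JFacts.cross`), finitary upgraded events
  containing the joint witnesses of the active slots on the piece (and the pivotal bond `b_k` on its line if
  used), and a bound of `∏_letters junF` by the target, a package with that target exists — the witnesses are the
  joint witnesses themselves and `b_k` (vacant on both levels, (4.57)–(4.61) p. 41, hence disjoint from all of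
  them); no sausage-bond line.  The terminal constructor `nonempty_jPkg_end_of` is the instance `k = M + 1`,
  `gl = glEnd`.
* §D: the middle / first junctions in closed form: `last = false`, which upper lines are active (`up j`,
  `j ≠ 5`, non-trivial slot), which lower lines (`lo 5` at a middle lower level; every non-trivial slot of
  level `0` at the first junction).
* §E: CLASSES VERSUS PARAMETERS at any level (the facts a middle provider reads off `JFacts`: exit class
  `0 ⇔ w_i = u_i`, `1 ⇒ (u_i, w_i)` an open lattice bond, `2`; inner class likewise for `(t_k, z_k)`; clause (8):
  at a `midE` level with `t_k ≠ u_{k+1}` (`F″`, (4.60) p. 41) the exit class is `2`), and the VACUOUS CELLS they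
  produce (classes inconsistent with the parameters; the rows `(·,0)`, `(·,1)` of `B^{(2),ι}`, App. B p. 76,
  which vanish) — packages with any target at any junction.

Conventions: `d`-generic; nothing is cited as a fact; additive (no existing declaration is changed).
-/

noncomputable section

namespace Literature.Probability.FitznerVanDerHofstad2017

open Literature.Barriers.CriticalPhenomena Literature.Probability.Percolation
open Literature.Probability.LatticeModels Literature.Combinatorics.SimpleGraph _root_.SimpleGraph
open _root_.MeasureTheory
open Literature.Probability.FitznerVanDerHofstad2017.NobleBlocks
open Literature.Probability.FitznerVanDerHofstad2017.NobleBlocks.LenIdx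
open scoped ENNReal

variable {d : ℕ}

/-! ### A. Tools: three letters; monotonicity of packages -/

section Tools

/-- A product of factors `≤ 1` is bounded by the product of any three of them. [folklore] -/
theorem prod_le_mul_mul_of_le_one {α : Type*} [Fintype α] [DecidableEq α] (X : α → ℝ≥0∞) (hX : ∀ l, X l ≤ 1)
    {l₁ l₂ l₃ : α} (h₁₂ : l₁ ≠ l₂) (h₁₃ : l₁ ≠ l₃) (h₂₃ : l₂ ≠ l₃) : ∏ l, X l ≤ X l₁ * X l₂ * X l₃ := by
  rw [← Finset.prod_erase_mul _ _ (Finset.mem_univ l₁),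
    ← Finset.prod_erase_mul _ _ (Finset.mem_erase.2 ⟨h₁₂.symm, Finset.mem_univ l₂⟩),
    ← Finset.prod_erase_mul _ _ (Finset.mem_erase.2 ⟨h₂₃.symm, Finset.mem_erase.2 ⟨h₁₃.symm, Finset.mem_univ l₃⟩⟩)]
  calc (∏ l ∈ ((Finset.univ.erase l₁).erase l₂).erase l₃, X l) * X l₃ * X l₂ * X l₁ ≤ 1 * X l₃ * X l₂ * X l₁ := by
        gcongr
        exact Finset.prod_le_one' fun l _ => hX l
    _ = X l₁ * X l₂ * X l₃ := by rw [one_mul]; ring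

variable {K : ℕ} {p : unitInterval} {C : JCtx d K}
  {F F' : (Fin K → BondConfig (Site d)) → (Fin K → Fin 6 → Set (Sym2 (Site d))) → Prop} {tgt tgt' : ℝ≥0∞}

/-- **Packages are monotone in the target.** [folklore] -/
def JPkg.mono (P : JPkg p C F tgt) (h : tgt ≤ tgt') : JPkg p C F tgt' where
  gl := P.gl
  A := P.A
  useB := P.useB
  useTZ := P.useTZ
  fin := P.fin
  memB := P.memB
  memTZ := P.memTZ
  htz := P.htz
  wit := P.wit
  bound := P.bound.trans (mul_le_mul' le_rfl h)

/-- **Packages are antitone in the facts**: a package for weaker facts serves stronger facts. [folklore] -/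
def JPkg.imp (P : JPkg p C F tgt) (h : ∀ ω K₀, F' ω K₀ → F ω K₀) : JPkg p C F' tgt where
  gl := P.gl
  A := P.A
  useB := P.useB
  useTZ := P.useTZ
  fin := P.fin
  memB := P.memB
  memTZ := P.memTZ
  htz := fun hT ω K₀ hF => P.htz hT ω K₀ (h ω K₀ hF)
  wit := fun ω K₀ hF => P.wit ω K₀ (h ω K₀ hF)
  bound := P.bound

/-- Monotonicity in the target, `Nonempty` form. [folklore] -/
theorem nonempty_jPkg_mono (h : tgt ≤ tgt') (hP : Nonempty (JPkg p C F tgt)) : Nonempty (JPkg p C F tgt') :=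
  ⟨hP.some.mono h⟩

end Tools

/-! ### B. The probability of a letter of a junction and its two-level reading -/

section Letters

variable (p : unitInterval) (M : ℕ) (x : Site d) (b : Fin (M + 2) → Site d × Site d) (w t z : Fin (M + 2) → Site d)
  (a : Fin (M + 2) → Fin 3 ⊕ Unit) (τ : Fin (M + 1) → Bool × Fin 3)

/-- The probability of the letter `l` of junction `k`, for the grouping `gl`, the bond lines in use `uB uT` and the
upgraded events `ev`: the `(M+3)`-level disjoint-occurrence probability of its active lines.
[cite: FitznerVanDerHofstad2017, §6.1 (6.4) (arXiv:1506.07977v2 p. 58)] -/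
def junF (k : Fin (M + 2)) (gl : JIdx → JIdx) (uB uT : Bool) (ev : JIdx → Set (BondConfig (Site d))) (l : JIdx) :
    ℝ≥0∞ :=
  piPerc d p (M + 3) (genDisjOcc (fun i : {i : JIdx // (jctx M x b w t z a τ k).Act uB uT i ∧ gl i = l} => ev i.1)
    fun i => (jctx M x b w t z a τ k).lv i.1)

/-- A letter has probability at most `1`. [folklore] -/
theorem junF_le_one (k : Fin (M + 2)) (gl : JIdx → JIdx) (uB uT : Bool) (ev : JIdx → Set (BondConfig (Site d)))
    (l : JIdx) : junF p M x b w t z a τ k gl uB uT ev l ≤ 1 :=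
  NobleBlocks.piPerc_le_one _ _ _

/-- **Reading a letter on two levels**: the letter `l` of junction `k` is bounded by the two-level probability of any
injectively indexed family of its active lines (level `k ↦ 0`, `k + 1 ↦ 1`).
[cite: FitznerVanDerHofstad2017, §4.2 (4.18) (arXiv:1506.07977v2 p. 35)] -/
theorem junF_le_of_lines (k : Fin (M + 2)) (gl : JIdx → JIdx) (uB uT : Bool) (ev : JIdx → Set (BondConfig (Site d)))
    (l : JIdx) {n : ℕ} (f : Fin n → JIdx) (hf : Function.Injective f)
    (hfl : ∀ m, (jctx M x b w t z a τ k).Act uB uT (f m) ∧ gl (f m) = l)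
    (c' : Fin n → Fin 2) (hc : ∀ m, (jctx M x b w t z a τ k).lv (f m) = ![k.castSucc, k.succ] (c' m))
    (B : Fin n → Set (BondConfig (Site d))) (hB : (fun m => ev (f m)) = B) :
    junF p M x b w t z a τ k gl uB uT ev l ≤ piPerc d p 2 (genDisjOcc B c') := by
  subst hB
  unfold junF
  refine (measure_mono (genDisjOcc_subset_reindex
    (fun m => (⟨f m, hfl m⟩ : {i : JIdx // (jctx M x b w t z a τ k).Act uB uT i ∧ gl i = l}))
    (fun m m' h => hf (congrArg Subtype.val h)) _ _)).trans (le_of_eq ?_)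
  exact piPerc_genDisjOcc_eq_two_of_comp p (jctx_lo_ne_up M x b w t z a τ k) _ c' hc

/-- The product of the letters against two designated ones. [folklore] -/
theorem prod_junF_le₂ (k : Fin (M + 2)) (gl : JIdx → JIdx) (uB uT : Bool) (ev : JIdx → Set (BondConfig (Site d)))
    {l₁ l₂ : JIdx} (h : l₁ ≠ l₂) :
    ∏ l, junF p M x b w t z a τ k gl uB uT ev l ≤ junF p M x b w t z a τ k gl uB uT ev l₁ * junF p M x b w t z a τ k gl uB uT ev l₂ :=
  prod_le_mul_of_le_one _ (junF_le_one p M x b w t z a τ k gl uB uT ev) h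

/-- The product of the letters against three designated ones. [folklore] -/
theorem prod_junF_le₃ (k : Fin (M + 2)) (gl : JIdx → JIdx) (uB uT : Bool) (ev : JIdx → Set (BondConfig (Site d)))
    {l₁ l₂ l₃ : JIdx} (h₁₂ : l₁ ≠ l₂) (h₁₃ : l₁ ≠ l₃) (h₂₃ : l₂ ≠ l₃) :
    ∏ l, junF p M x b w t z a τ k gl uB uT ev l ≤
      junF p M x b w t z a τ k gl uB uT ev l₁ * junF p M x b w t z a τ k gl uB uT ev l₂ * junF p M x b w t z a τ k gl uB uT ev l₃ :=
  prod_le_mul_mul_of_le_one _ (junF_le_one p M x b w t z a τ k gl uB uT ev) h₁₂ h₁₃ h₂₃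

end Letters

/-! ### C. The generic package from the joint witnesses -/

section Joint

variable (p : unitInterval) {M : ℕ} {x : Site d} {b : Fin (M + 2) → Site d × Site d} {w t z : Fin (M + 2) → Site d}
  {a : Fin (M + 2) → Fin 3 ⊕ Unit} {c : Fin 3 ⊕ Unit} {τ : Fin (M + 1) → Bool × Fin 3}

/-- **THE GENERIC PACKAGE OF A JUNCTION FROM THE JOINT WITNESSES** (no sausage-bond line).  Data: the junction
`k`, a grouping `gl` of its local lines into letters whose cross-level letters join lower lines only with ENTRY
slots of the upper level, whether the pivotal-bond line is used (`uB`; then `{b_k} ∈ ev xb`), finitary upgraded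
events `ev` which, on the piece, contain the joint witness of every active slot, and the letter estimate
`∏_l junF l ≤ tgt`.  Then a package with target `tgt` exists: witnesses = the joint witnesses and the bond `b_k`;
the compatibility (4.57)–(4.61), (4.65) is read off `JFacts` (`off/disj/cross/disjoint_fbN`) and the vacancy of
`b_k` on both levels.
[cite: FitznerVanDerHofstad2017, §6.1 (6.4) (arXiv:1506.07977v2 p. 58); §4.4 (4.57)–(4.61), (4.65) (pp. 41, 43)] -/
theorem nonempty_jPkg_of_joint (k : Fin (M + 2)) (gl : JIdx → JIdx) (uB : Bool)
    (ev : JIdx → Set (BondConfig (Site d))) (hfin : ∀ i, IsFinitary (ev i))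
    (hB : uB = true → ({s((b k).1, (b k).2)} : Set (Sym2 (Site d))) ∈ ev .xb)
    (hgl : ∀ j j', (jctx M x b w t z a τ k).Act uB false (.lo j) → (jctx M x b w t z a τ k).Act uB false (.up j') →
      gl (.lo j) = gl (.up j') → IsEntry (pieceViews M x b w t z a τ k.succ).kd j')
    (hmem : ∀ ω K₀, JFacts M x b w t z a c τ ω K₀ →
      (∀ j, (jctx M x b w t z a τ k).Act uB false (.lo j) → K₀ k.castSucc j ∈ ev (.lo j)) ∧
        ∀ j, (jctx M x b w t z a τ k).Act uB false (.up j) → K₀ k.succ j ∈ ev (.up j))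
    {tgt : ℝ≥0∞} (hrow : ∏ l, junF p M x b w t z a τ k gl uB false ev l ≤ tgt) :
    Nonempty (JPkg p (jctx M x b w t z a τ k) (JFacts M x b w t z a c τ) tgt) := by
  refine ⟨{ gl := gl, A := ev, useB := uB, useTZ := false, fin := hfin, memB := hB
            memTZ := fun h => absurd h Bool.false_ne_true, htz := fun h => absurd h Bool.false_ne_true
            wit := fun ω K₀ hF => ?_, bound := ?_ }⟩
  · -- the re-witnessing: the joint witnesses themselves
    obtain ⟨h1, h2, h3, h4, hlu, h6⟩ := hF.compat k
    have hm := hmem ω K₀ hF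
    have hbL : ∀ j, s((b k).1, (b k).2) ∉ K₀ k.castSucc j := fun j hm' =>
      ((h1 j) hm').2 (bK_mem_off_castSucc (x := x) (w := w) (t := t) (z := z) (a := a) (τ := τ) k)
    have hbU : ∀ j, s((b k).1, (b k).2) ∉ K₀ k.succ j := fun j hm' =>
      ((h2 j) hm').2 (bK_mem_off_succ (x := x) (w := w) (t := t) (z := z) (a := a) (τ := τ) k)
    refine ⟨Sum.elim (K₀ k.castSucc) (K₀ k.succ), ?_, ?_, ?_, ?_, ?_⟩
    · intro j hj
      exact ⟨h1 j, hm.1 j hj⟩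
    · intro j hj
      exact ⟨h2 j, hm.2 j hj⟩
    · intro _ _
      exact subset_rfl
    · intro hl j hj
      have hj5 : j ≠ 5 := by
        rcases hj.1 with h' | h'
        · rw [hl] at h'; exact absurd h' (by decide)
        · exact h'
      exact ⟨h4 j 5 hj5, h6 j hj.2⟩
    · intro i i' hi hi' hne hrel
      cases i with
      | lo j =>
        cases i' with
        | lo j' => exact h3 j j' fun hjj => hne (by rw [hjj])
        | up j' =>
          have hg : gl (.lo j) = gl (.up j') := by
            rcases hrel with h' | h'
            · exact absurd h' hlu
            · exact h'
          exact (hF.cross k j j' (hgl j j' hi hi' hg)).symm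
        | xb => exact Set.disjoint_singleton_right.2 (hbL j)
        | xtz => exact absurd hi' Bool.false_ne_true
      | up j =>
        cases i' with
        | lo j' =>
          have hg : gl (.lo j') = gl (.up j) := by
            rcases hrel with h' | h'
            · exact absurd h'.symm hlu
            · exact h'.symm
          exact hF.cross k j' j (hgl j' j hi' hi hg)
        | up j' => exact h4 j j' fun hjj => hne (by rw [hjj])
        | xb => exact Set.disjoint_singleton_right.2 (hbU j)
        | xtz => exact absurd hi' Bool.false_ne_true
      | xb =>
        cases i' with
        | lo j' => exact Set.disjoint_singleton_left.2 (hbL j')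
        | up j' => exact Set.disjoint_singleton_left.2 (hbU j')
        | xb => exact absurd rfl hne
        | xtz => exact absurd hi' Bool.false_ne_true
      | xtz => exact absurd hi Bool.false_ne_true
  · -- the letter bound
    show ∏ l, junF p M x b w t z a τ k gl uB false ev l ≤ _
    rw [Bool.toNat_false, pow_zero, one_mul]
    exact hrow

end Joint

/-! ### D. The middle and first junctions in closed form -/

section Middle

variable (M : ℕ) (x : Site d) (b : Fin (M + 2) → Site d × Site d) (w t z : Fin (M + 2) → Site d)
  (a : Fin (M + 2) → Fin 3 ⊕ Unit) (τ : Fin (M + 1) → Bool × Fin 3)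

/-- A junction `k ≤ M` is not the last one. [folklore] -/
theorem jMid_last (i : Fin (M + 1)) : (jctx M x b w t z a τ i.castSucc).last = false := by
  rw [jctx_last, decide_eq_false_iff_not]
  exact (Fin.castSucc_lt_last i).ne

/-- The junction `k` is the first one iff `k = 0`. [folklore] -/
theorem jctx_first_eq_true_iff (k : Fin (M + 2)) : (jctx M x b w t z a τ k).first = true ↔ k = 0 := by
  rw [jctx_first, decide_eq_true_iff]

/-- The upper level of a junction `k ≤ M` is the middle level `k + 1`, in closed form.
[cite: FitznerVanDerHofstad2017, (4.59)–(4.62) (arXiv:1506.07977v2 p. 41)] -/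
theorem jMid_VU (i : Fin (M + 1)) :
    (jctx M x b w t z a τ i.castSucc).VU =
      ⟨midKind (a i.succ).isRight (τ i).1, (b i.castSucc).1, (b i.castSucc).2, t i.castSucc, z i.castSucc,
        (b i.succ).1, (b i.succ).2, w i.succ, z i.succ,
        bondsAt {(b i.castSucc).1} ∪ {s((b i.succ).1, (b i.succ).2)}⟩ := by
  rw [jctx_VU_castSucc, pieceViews_mid]

/-- The kind of the upper level of a junction `k ≤ M`. [cite: FitznerVanDerHofstad2017, (4.59)–(4.62) (arXiv:1506.07977v2 p. 41)] -/
theorem jMid_VU_kd (i : Fin (M + 1)) :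
    (jctx M x b w t z a τ i.castSucc).VU.kd = midKind (a i.succ).isRight (τ i).1 := by
  rw [jMid_VU]

/-- The kind of the middle level `k + 1`. [cite: FitznerVanDerHofstad2017, (4.59)–(4.62) (arXiv:1506.07977v2 p. 41)] -/
theorem pieceViews_mid_kd (i : Fin (M + 1)) :
    (pieceViews M x b w t z a τ i.castSucc.succ).kd = midKind (a i.succ).isRight (τ i).1 := by
  rw [pieceViews_mid]

/-- At a junction `k ≤ M` an upper line `up j` is active iff `j ≠ 5` and its slot is non-trivial.
[cite: FitznerVanDerHofstad2017, (4.59)–(4.61) (arXiv:1506.07977v2 p. 41)] -/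
theorem jMid_act_up_iff (i : Fin (M + 1)) (uB uT : Bool) (j : Fin 6) :
    (jctx M x b w t z a τ i.castSucc).Act uB uT (.up j) ↔
      j ≠ 5 ∧ ¬ IsTriv (midKind (a i.succ).isRight (τ i).1) j := by
  rw [show (jctx M x b w t z a τ i.castSucc).Act uB uT (.up j) ↔
      ((jctx M x b w t z a τ i.castSucc).last = true ∨ j ≠ 5) ∧ ¬ IsTriv (jctx M x b w t z a τ i.castSucc).VU.kd j
    from Iff.rfl, jMid_last, jMid_VU_kd]
  simp

/-- At a junction `k ≤ M` the upper exit line `up 5` is never active (it belongs to the next junction).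
[cite: FitznerVanDerHofstad2017, §6.1 (6.4) (arXiv:1506.07977v2 p. 58)] -/
theorem jMid_not_act_up_five (i : Fin (M + 1)) (uB uT : Bool) :
    ¬ (jctx M x b w t z a τ i.castSucc).Act uB uT (.up 5) := by
  rw [jMid_act_up_iff]
  exact fun h => h.1 rfl

/-- At a junction `1 ≤ k` a lower line `lo j` is active iff `j = 5` and the exit slot is non-trivial.
[cite: FitznerVanDerHofstad2017, (4.59)–(4.61) (arXiv:1506.07977v2 p. 41)] -/
theorem jSucc_act_lo_iff (i : Fin (M + 1)) (uB uT : Bool) (j : Fin 6) :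
    (jctx M x b w t z a τ i.succ).Act uB uT (.lo j) ↔
      j = 5 ∧ ¬ IsTriv (pieceViews M x b w t z a τ i.castSucc.succ).kd j := by
  rw [show (jctx M x b w t z a τ i.succ).Act uB uT (.lo j) ↔
      ((jctx M x b w t z a τ i.succ).first = true ∨ j = 5) ∧ ¬ IsTriv (jctx M x b w t z a τ i.succ).VL.kd j
    from Iff.rfl, jctx_first_eq_true_iff, jctx_VL_succ]
  simp [Fin.succ_ne_zero]

/-- At the first junction a lower line `lo j` is active iff its slot of level `0` is non-trivial.
[cite: FitznerVanDerHofstad2017, (4.57) (arXiv:1506.07977v2 p. 41)] -/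
theorem jZero_act_lo_iff (uB uT : Bool) (j : Fin 6) :
    (jctx M x b w t z a τ 0).Act uB uT (.lo j) ↔ ¬ IsTriv LvKind.zero j := by
  rw [show (jctx M x b w t z a τ 0).Act uB uT (.lo j) ↔
      ((jctx M x b w t z a τ 0).first = true ∨ j = 5) ∧ ¬ IsTriv (jctx M x b w t z a τ 0).VL.kd j
    from Iff.rfl, jctx_first_eq_true_iff, jctx_VL_zero, pieceViews_zero]
  simp

/-- The levels of the local lines of junction `k`: lower lines and bond lines on `k`, upper lines on `k + 1`.
[folklore] -/
theorem jctx_lv (k : Fin (M + 2)) :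
    (∀ j, (jctx M x b w t z a τ k).lv (.lo j) = k.castSucc) ∧ (∀ j, (jctx M x b w t z a τ k).lv (.up j) = k.succ) ∧
      (jctx M x b w t z a τ k).lv .xb = k.castSucc ∧ (jctx M x b w t z a τ k).lv .xtz = k.castSucc :=
  ⟨fun _ => rfl, fun _ => rfl, rfl, rfl⟩

end Middle

/-! ### E. Classes versus parameters: the facts a middle provider reads, and the vacuous cells -/

section Classes

variable {p : unitInterval} {M : ℕ} {x : Site d} {b : Fin (M + 2) → Site d × Site d} {w t z : Fin (M + 2) → Site d}
  {a : Fin (M + 2) → Fin 3 ⊕ Unit} {c : Fin 3 ⊕ Unit} {τ : Fin (M + 1) → Bool × Fin 3}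
  {ω : Fin (M + 3) → BondConfig (Site d)} {K₀ : Fin (M + 3) → Fin 6 → Set (Sym2 (Site d))}

namespace JFacts

/-- Exit class `0` of an open level `i`: `w_i = u_i`. [cite: FitznerVanDerHofstad2017, §6.1 "Case a = 0" (arXiv:1506.07977v2 p. 58)] -/
theorem w_eq_of_exitClass_zero (h : JFacts M x b w t z a c τ ω K₀) (i : Fin (M + 2)) (ha : a i = Sum.inl 0) :
    w i = (b i).1 :=
  ((lineClass_eq_zero_iff _ _ _).1 (h.exitClass i 0 ha)).symm

/-- Exit class `≠ 0` of an open level `i`: `u_i ≠ w_i`. [cite: FitznerVanDerHofstad2017, §6.1 "Case a = 1, a ≥ 2" (arXiv:1506.07977v2 pp. 58–59)] -/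
theorem u_ne_w_of_exitClass_ne_zero (h : JFacts M x b w t z a c τ ω K₀) (i : Fin (M + 2)) {a₀ : Fin 3}
    (ha : a i = Sum.inl a₀) (h0 : a₀ ≠ 0) : (b i).1 ≠ w i :=
  fun he => h0 ((h.exitClass i a₀ ha).symm.trans ((lineClass_eq_zero_iff _ _ _).2 he))

/-- Exit class `1` of an open level `i`: `(u_i, w_i)` is an open bond of level `i`, in particular a lattice bond.
[cite: FitznerVanDerHofstad2017, §6.1 "Case a = 1" (arXiv:1506.07977v2 p. 59)] -/
theorem exitClass_one (h : JFacts M x b w t z a c τ ω K₀) (i : Fin (M + 2)) (ha : a i = Sum.inl 1) :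
    (b i).1 ≠ w i ∧ s((b i).1, w i) ∈ ω i.castSucc ∧ (zdGraph d).Adj (b i).1 (w i) := by
  have h1 := (lineClass_eq_one_iff _ _ _).1 (h.exitClass i 1 ha)
  exact ⟨h1.1, h1.2, (SimpleGraph.mem_edgeSet _).1 (h.lattice _ h1.2)⟩

/-- Exit class `2` of an open level `i`: `u_i ≠ w_i` and the bond (if any) is not open on level `i`.
[cite: FitznerVanDerHofstad2017, §6.1 "Case a ≥ 2" (arXiv:1506.07977v2 p. 59)] -/
theorem exitClass_two (h : JFacts M x b w t z a c τ ω K₀) (i : Fin (M + 2)) (ha : a i = Sum.inl 2) :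
    (b i).1 ≠ w i ∧ s((b i).1, w i) ∉ ω i.castSucc :=
  (lineClass_eq_two_iff _ _ _).1 (h.exitClass i 2 ha)

/-- Inner class `0` of junction `k ≤ M`: `t_k = z_k`. [cite: FitznerVanDerHofstad2017, §6.1 "Case b = 0" (arXiv:1506.07977v2 p. 59)] -/
theorem t_eq_z_of_innerClass_zero (h : JFacts M x b w t z a c τ ω K₀) (i : Fin (M + 1)) (h0 : (τ i).2 = 0) :
    t i.castSucc = z i.castSucc :=
  (lineClass_eq_zero_iff _ _ _).1 ((h.innerClass i).trans h0)

/-- Inner class `≠ 0` of junction `k ≤ M`: `t_k ≠ z_k`. [cite: FitznerVanDerHofstad2017, §6.1 "Case b = 1, b ≥ 2" (arXiv:1506.07977v2 p. 59)] -/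
theorem t_ne_z_of_innerClass_ne_zero (h : JFacts M x b w t z a c τ ω K₀) (i : Fin (M + 1)) (h0 : (τ i).2 ≠ 0) :
    t i.castSucc ≠ z i.castSucc :=
  fun he => h0 ((h.innerClass i).symm.trans ((lineClass_eq_zero_iff _ _ _).2 he))

/-- Inner class `1` of junction `k ≤ M`: `(t_k, z_k)` is an open bond of level `k + 1`, in particular a lattice
bond. [cite: FitznerVanDerHofstad2017, §6.1 "Case b = 1" (arXiv:1506.07977v2 p. 59)] -/
theorem innerClass_one (h : JFacts M x b w t z a c τ ω K₀) (i : Fin (M + 1)) (h1 : (τ i).2 = 1) :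
    t i.castSucc ≠ z i.castSucc ∧ s(t i.castSucc, z i.castSucc) ∈ ω i.castSucc.succ ∧
      (zdGraph d).Adj (t i.castSucc) (z i.castSucc) := by
  have h1' := (lineClass_eq_one_iff _ _ _).1 ((h.innerClass i).trans h1)
  exact ⟨h1'.1, h1'.2, (SimpleGraph.mem_edgeSet _).1 (h.lattice _ h1'.2)⟩

/-- Inner class `2` of junction `k ≤ M`: `t_k ≠ z_k` and the bond (if any) is not open on level `k + 1`.
[cite: FitznerVanDerHofstad2017, §6.1 "Case b ≥ 2" (arXiv:1506.07977v2 p. 59)] -/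
theorem innerClass_two (h : JFacts M x b w t z a c τ ω K₀) (i : Fin (M + 1)) (h2 : (τ i).2 = 2) :
    t i.castSucc ≠ z i.castSucc ∧ s(t i.castSucc, z i.castSucc) ∉ ω i.castSucc.succ :=
  (lineClass_eq_two_iff _ _ _).1 ((h.innerClass i).trans h2)

/-- **Clause (8) read at a middle level of kind `midE` off its end vertex** (`F″`: `t_{k} ≠ u_{k+1}`): the exit
class of level `k + 1` is `2`. [cite: FitznerVanDerHofstad2017, (4.60) "F″" and §6.1 "Case a ≥ 2" (arXiv:1506.07977v2 pp. 41, 59)] -/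
theorem exitClass_succ_eq_two_of_sharp (h : JFacts M x b w t z a c τ ω K₀) (i : Fin (M + 1)) (hσ : (τ i).1 = true)
    {a₀ : Fin 3} (ha : a i.succ = Sum.inl a₀) (ht : t i.castSucc ≠ (b i.succ).1) : a₀ = 2 := by
  have hs : clsS M a i.succ = false := by rw [clsS_apply, ha]; rfl
  have hσ' : sigOf M τ i.succ = true := by rw [sigOf_succ, hσ]
  exact (h.exitClass i.succ a₀ ha).symm.trans (lineClass_exit_eq_two_of_mem_jointWitN h.mem_jointWitN i hs hσ' ht)

end JFacts

variable (p c)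

/-- VACUOUS CELL: exit class `0` handed with `u_i ≠ w_i`. [cite: FitznerVanDerHofstad2017, §6.1 "Case a = 0" (arXiv:1506.07977v2 p. 58)] -/
theorem nonempty_jPkg_of_exitClass_zero_ne (k : Fin (M + 2)) (i : Fin (M + 2)) (ha : a i = Sum.inl 0)
    (hne : (b i).1 ≠ w i) (tgt : ℝ≥0∞) : Nonempty (JPkg p (jctx M x b w t z a τ k) (JFacts M x b w t z a c τ) tgt) :=
  ⟨JPkg.vacuous p _ _ (fun _ _ hF => hne (hF.w_eq_of_exitClass_zero i ha).symm) tgt⟩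

/-- VACUOUS CELL: exit class `≠ 0` handed with `u_i = w_i`. [cite: FitznerVanDerHofstad2017, §6.1 "Case a = 1, a ≥ 2" (arXiv:1506.07977v2 pp. 58–59)] -/
theorem nonempty_jPkg_of_exitClass_ne_zero_eq (k : Fin (M + 2)) (i : Fin (M + 2)) {a₀ : Fin 3} (ha : a i = Sum.inl a₀)
    (h0 : a₀ ≠ 0) (heq : (b i).1 = w i) (tgt : ℝ≥0∞) :
    Nonempty (JPkg p (jctx M x b w t z a τ k) (JFacts M x b w t z a c τ) tgt) :=
  ⟨JPkg.vacuous p _ _ (fun _ _ hF => hF.u_ne_w_of_exitClass_ne_zero i ha h0 heq) tgt⟩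

/-- VACUOUS CELL: exit class `1` handed with `(u_i, w_i)` not a lattice bond. [cite: FitznerVanDerHofstad2017, §6.1 "Case a = 1" (arXiv:1506.07977v2 p. 59)] -/
theorem nonempty_jPkg_of_exitClass_one_not_adj (k : Fin (M + 2)) (i : Fin (M + 2)) (ha : a i = Sum.inl 1)
    (hn : ¬ (zdGraph d).Adj (b i).1 (w i)) (tgt : ℝ≥0∞) :
    Nonempty (JPkg p (jctx M x b w t z a τ k) (JFacts M x b w t z a c τ) tgt) :=
  ⟨JPkg.vacuous p _ _ (fun _ _ hF => hn (hF.exitClass_one i ha).2.2) tgt⟩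

/-- VACUOUS CELL: inner class `0` handed with `t_k ≠ z_k`. [cite: FitznerVanDerHofstad2017, §6.1 "Case b = 0" (arXiv:1506.07977v2 p. 59)] -/
theorem nonempty_jPkg_of_innerClass_zero_ne (k : Fin (M + 2)) (i : Fin (M + 1)) (h0 : (τ i).2 = 0)
    (hne : t i.castSucc ≠ z i.castSucc) (tgt : ℝ≥0∞) :
    Nonempty (JPkg p (jctx M x b w t z a τ k) (JFacts M x b w t z a c τ) tgt) :=
  ⟨JPkg.vacuous p _ _ (fun _ _ hF => hne (hF.t_eq_z_of_innerClass_zero i h0)) tgt⟩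

/-- VACUOUS CELL: inner class `≠ 0` handed with `t_k = z_k`. [cite: FitznerVanDerHofstad2017, §6.1 "Case b = 1, b ≥ 2" (arXiv:1506.07977v2 p. 59)] -/
theorem nonempty_jPkg_of_innerClass_ne_zero_eq (k : Fin (M + 2)) (i : Fin (M + 1)) (h0 : (τ i).2 ≠ 0)
    (heq : t i.castSucc = z i.castSucc) (tgt : ℝ≥0∞) :
    Nonempty (JPkg p (jctx M x b w t z a τ k) (JFacts M x b w t z a c τ) tgt) :=
  ⟨JPkg.vacuous p _ _ (fun _ _ hF => hF.t_ne_z_of_innerClass_ne_zero i h0 heq) tgt⟩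

/-- VACUOUS CELL: inner class `1` handed with `(t_k, z_k)` not a lattice bond. [cite: FitznerVanDerHofstad2017, §6.1 "Case b = 1" (arXiv:1506.07977v2 p. 59)] -/
theorem nonempty_jPkg_of_innerClass_one_not_adj (k : Fin (M + 2)) (i : Fin (M + 1)) (h1 : (τ i).2 = 1)
    (hn : ¬ (zdGraph d).Adj (t i.castSucc) (z i.castSucc)) (tgt : ℝ≥0∞) :
    Nonempty (JPkg p (jctx M x b w t z a τ k) (JFacts M x b w t z a c τ) tgt) :=
  ⟨JPkg.vacuous p _ _ (fun _ _ hF => hn (hF.innerClass_one i h1).2.2) tgt⟩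

/-- **VACUOUS CELLS OF `F″`**: at a middle level `k + 1` of kind `midE` with `t_k ≠ u_{k+1}` the exit class is
`2` (clause (8)), so the pieces handed with exit class `0` or `1` there are empty and carry a package with any
target — the App. B rows `(·, 0)`, `(·, 1)` of `B^{(2),ι}` vanish ([FvdH17] p. 76: "`B^{(2)}_{·,0} = B^{(2)}_{·,1} = 0`").
[cite: FitznerVanDerHofstad2017, (4.60) and App. B Table `B^{(2),ι}` rows b = 0, 1 (arXiv:1506.07977v2 pp. 41, 76)] -/
theorem nonempty_jPkg_of_sharp (k : Fin (M + 2)) (i : Fin (M + 1)) (hσ : (τ i).1 = true) {a₀ : Fin 3}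
    (ha : a i.succ = Sum.inl a₀) (ha2 : a₀ ≠ 2) (ht : t i.castSucc ≠ (b i.succ).1) (tgt : ℝ≥0∞) :
    Nonempty (JPkg p (jctx M x b w t z a τ k) (JFacts M x b w t z a c τ) tgt) :=
  ⟨JPkg.vacuous p _ _ (fun _ _ hF => ha2 (hF.exitClass_succ_eq_two_of_sharp i hσ ha ht)) tgt⟩

end Classes

end Literature.Probability.FitznerVanDerHofstad2017

end
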